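import Summits.Langlands.Langlands.Theses.HeckeFieldDeRham
import Summits.Langlands.Langlands.Theorems.IrreducibilityBySelfDualityReciprocityUpToIrreducibilityCorrespondsConj

/-!
# Line `leaves` — crux `HeckeFieldDeRham.ReciprocityModuloDeRham` (stmt-Langlands-17410), crux-strategist gen 1

`ReciprocityModuloDeRham` (RMD) is the route's declared open component: the summit `Langlands` with the
`p`-adic-Hodge (de Rham) clause of direction (A) removed (one `Rec` per field; (A°) = irreducible avatar, Satake
matching a.e., local–global compatibility (LGC) at `v ∤ ℓ`, LGC at `v ∣ ℓ` conditional on de Rham, uniqueness up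
to conjugacy; (B) verbatim).  `Langlands → RMD` is proved (refuter, RMDProbes.lean), so no technique short of the
summit closes it; this line is its finest TYPED PARTITION along the conjecture's own seams, modulo de Rham:

* `stub_satakeAvatarExistence`  (W⁺, OPEN) — VERBATIM item stmt-Langlands-17415 `PrimeSwitchSplit.SatakeAvatarExistence`:
  every L-algebraic cuspidal `π` has an IRREDUCIBLE `ℓ`-adic avatar at Satake level (Buzzard–Gee Conj. 3.2.2 weak form +
  Ramakrishnan irreducibility); no `p`-adic Hodge clause — exactly what (A°) asks of the avatar.  Irreducibility must be
  ASSUMED here: the isobaric bootstrap that derives it on the summit (B_w on the constituents + Jacquet–Shalika) needs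
  de Rham constituents, which RMD does not provide.
* `stub_weakGeometricAutomorphy` (B_w, OPEN) — VERBATIM item stmt-Langlands-17414 `PrimeSwitchSplit.WeakGeometricAutomorphy`:
  Fontaine–Mazur–Langlands, a.e. form (irreducible pinned-geometric `ρ` is Satake-compatible a.e. with an L-algebraic cuspidal `π`).
* `stub_pairCompatibilityModuloDeRham` (LGC°, OPEN, NEW) — Taylor 2004 Conj. 7 for irreducible Satake-compatible pairs at
  every finite place where the de Rham condition holds (hypothesis vacuous at `v ∤ ℓ`), one `Rec` per field, NO geometric
  hypothesis on `ρ` (a consequence of the summit by the weak-to-strong upgrade: bc/LeavesOfLanglands.lean).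

The composition `ReciprocityModuloDeRham_of` is kernel-checked and sorry-free; the uniqueness clause of (A°) is discharged
IN THE SEAM by the landed theorem `Theorems.ReciprocityUpToIrreducibility.isConjugate_of_satakeFrobCompatibleAt`
(Chebotarev + Brauer–Nesbitt, Deligne–Serre Lemme 3.2; p119850), applied to `Corresponds.1` of the competitor.
-/

set_option linter.dupNamespace false

namespace Summit.Langlands.Langlands.Cruxes.ReciprocityModuloDeRham.Leaves

open scoped BigOperators Topology Manifold Classical MeasureTheory ProbabilityTheory Matrix InnerProductSpace ComplexConjugate ContinuousMap
open Filter Set Function TopologicalSpace MeasureTheory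
open Summit.Langlands Summit.Langlands.Langlands.Theses.HeckeFieldDeRham

/-- **W⁺ — irreducible Satake-level avatar (OPEN; VERBATIM stmt-Langlands-17415).**  Known: regular algebraic `π` over
CM / totally real `K` (Harris–Lan–Taylor–Thorne 2016 Thm A, Scholze 2015; irreducibility in low rank / regular cases:
Ribet, Taylor, Blasius–Rogawski, Calegari–Gee, Böckle–Hui); OPEN for irregular `π` (NonRegularWeightBarrier) and general `K`
(ShimuraVarietyRealizationBarrier). [cite: BuzzardGeeLMS2014, Conj. 3.2.2] [cite: HarrisLanTaylorThorneRMS2016, Thm. A] -/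
theorem stub_satakeAvatarExistence :
    ∀ (K : Type) [Field K] [NumberField K] (n : ℕ) (hcpt : Literature.NumberTheory.Automorphic.isCompact_glFiniteIntegralLevel n K), 0 < n → ∀ (π : Literature.NumberTheory.Automorphic.CuspidalAutomorphicRepData n K hcpt), π.1.IsLAlgebraic → ∀ (ℓ : ℕ) [Fact ℓ.Prime] (ι : PadicAlgCl ℓ ≃+* ℂ), ∃ ρ : Literature.NumberTheory.GaloisRepresentations.FramedGaloisRep K (PadicAlgCl ℓ) n, ρ.toGaloisRep.IsIrreducible ∧ ∀ᶠ v : IsDedekindDomain.HeightOneSpectrum (NumberField.RingOfIntegers K) in cofinite, SatakeFrobCompatibleAt ι π.1 ρ v := by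
  sorry

/-- **B_w — weak geometric automorphy (OPEN; VERBATIM stmt-Langlands-17414).**  Fontaine–Mazur Conj. 1 + Langlands,
almost-everywhere form, all `n` and `K`; known for `GL₁`, odd `GL₂/ℚ` (Kisin, Emerton, Pan), regular Hodge–Tate weights under
automorphy-lifting provisos over CM / totally real fields (BLGGT, 10-author); contains the strong Artin conjecture.
[cite: FontaineMazurGeometric1995, Conj. 1] [cite: BuzzardGeeLMS2014, Conj. 3.2.2] -/
theorem stub_weakGeometricAutomorphy :
    ∀ (K : Type) [Field K] [NumberField K] (n : ℕ) (hcpt : Literature.NumberTheory.Automorphic.isCompact_glFiniteIntegralLevel n K), 0 < n → ∀ (ℓ : ℕ) [Fact ℓ.Prime] (ι : PadicAlgCl ℓ ≃+* ℂ) (ρ : Literature.NumberTheory.GaloisRepresentations.FramedGaloisRep K (PadicAlgCl ℓ) n), ρ.toGaloisRep.IsIrreducible → ((∀ᶠ v : IsDedekindDomain.HeightOneSpectrum (NumberField.RingOfIntegers K) in cofinite, ρ.IsUnramifiedAt v) ∧ ∀ (v : IsDedekindDomain.HeightOneSpectrum (NumberField.RingOfIntegers K)) (hv : ((ℓ : ℕ)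 : NumberField.RingOfIntegers K) ∈ v.asIdeal), (Literature.NumberTheory.PAdicHodge.fontainePstAdicCompletion v ℓ hv).IsDeRhamFramed (ρ.toLocal v)) → ∃ π : Literature.NumberTheory.Automorphic.CuspidalAutomorphicRepData n K hcpt, π.1.IsLAlgebraic ∧ ∀ᶠ v : IsDedekindDomain.HeightOneSpectrum (NumberField.RingOfIntegers K) in cofinite, SatakeFrobCompatibleAt ι π.1 ρ v := by
  sorry

/-- **LGC° — local–global compatibility modulo de Rham (OPEN; NEW leaf).**  For ONE reciprocity datum per field: an
IRREDUCIBLE `ρ` Satake–Frobenius compatible a.e. with an L-algebraic cuspidal `π` satisfies Taylor's Conj. 7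
(`LocalGlobalCompatibleAt`) at every finite `v` at which it is de Rham whenever `v ∣ ℓ` (hypothesis vacuous at `v ∤ ℓ`:
Grothendieck–Deligne side, Carayol / Harris–Taylor / Taylor–Yoshida / Caraiani / Varma 2024 for regular `π` over CM up to
monodromy `≺`; at `v ∣ ℓ` through Fontaine's pinned `D_pst`: A'Campo–Hevesi–Thorne–Whitmore for regular `π` over CM,
semisimplified).  No geometric hypothesis on `ρ`; implied by the summit (weak-to-strong upgrade p119850).
[cite: HarrisTaylorAMS2001, Thm. A] [cite: VarmaFMS2024, Thm. 1] -/
theorem stub_pairCompatibilityModuloDeRham :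
    ∀ (K : Type) [Field K] [NumberField K], ∃ Rec : ReciprocityData K, ∀ (n : ℕ) (hcpt : Literature.NumberTheory.Automorphic.isCompact_glFiniteIntegralLevel n K), 0 < n → ∀ (π : Literature.NumberTheory.Automorphic.CuspidalAutomorphicRepData n K hcpt), π.1.IsLAlgebraic → ∀ (ℓ : ℕ) [Fact ℓ.Prime] (ι : PadicAlgCl ℓ ≃+* ℂ) (ρ : Literature.NumberTheory.GaloisRepresentations.FramedGaloisRep K (PadicAlgCl ℓ) n), ρ.toGaloisRep.IsIrreducible → (∀ᶠ v : IsDedekindDomain.HeightOneSpectrum (NumberField.RingOfIntegers K) in cofinite, SatakeFrobCompatibleAt ι π.1 ρ v) → ∀ v : IsDedekindDomain.HeightOneSpectrum (NumberField.RingOfIntegers K), (∀ hv : ((ℓ : ℕ) : NumberField.RingOfIntegers K) ∈ v.asIdeal, (Rec.pst ℓ v hv).IsDeRhamFramed (ρ.toLocal v)) → LocalGlobalCompatibleAt Rec ι π.1 ρ v := by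
  sorry

/-- **Composition (sorry-free): W⁺ → B_w → LGC° → `ReciprocityModuloDeRham`, concluded BY NAME.**  Take `Rec` from LGC°;
(A°): the avatar of W⁺, LGC° with the de Rham hypothesis vacuous at `v ∤ ℓ` and supplied at `v ∣ ℓ`, uniqueness by the
landed `isConjugate_of_satakeFrobCompatibleAt` on `Corresponds.1`; (B): B_w (the pinned `Rec.pst` is Fontaine's datum by
`rfl`) and LGC° with de Rham from geometricity. [cite: BuzzardGeeLMS2014, Conj. 3.2.2] -/
theorem ReciprocityModuloDeRham_of :
    (∀ (K : Type) [Field K] [NumberField K] (n : ℕ) (hcpt : Literature.NumberTheory.Automorphic.isCompact_glFiniteIntegralLevel n K), 0 < n → ∀ (π : Literature.NumberTheory.Automorphic.CuspidalAutomorphicRepData n K hcpt), π.1.IsLAlgebraic → ∀ (ℓ : ℕ) [Fact ℓ.Prime] (ι : PadicAlgCl ℓ ≃+* ℂ), ∃ ρ : Literature.NumberTheory.GaloisRepresentations.FramedGaloisRep K (PadicAlgCl ℓ) n, ρ.toGaloisRep.IsIrreducible ∧ ∀ᶠ v : IsDedekindDomain.HeightOneSpectrum (NumberField.RingOfIntegers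 K) in cofinite, SatakeFrobCompatibleAt ι π.1 ρ v) →
    (∀ (K : Type) [Field K] [NumberField K] (n : ℕ) (hcpt : Literature.NumberTheory.Automorphic.isCompact_glFiniteIntegralLevel n K), 0 < n → ∀ (ℓ : ℕ) [Fact ℓ.Prime] (ι : PadicAlgCl ℓ ≃+* ℂ) (ρ : Literature.NumberTheory.GaloisRepresentations.FramedGaloisRep K (PadicAlgCl ℓ) n), ρ.toGaloisRep.IsIrreducible → ((∀ᶠ v : IsDedekindDomain.HeightOneSpectrum (NumberField.RingOfIntegers K) in cofinite, ρ.IsUnramifiedAt v) ∧ ∀ (v : IsDedekindDomain.HeightOneSpectrum (NumberField.RingOfIntegers K)) (hv : ((ℓ : ℕ) : NumberField.RingOfIntegers K) ∈ v.asIdeal), (Literature.NumberTheory.PAdicHodge.fontainePstAdicCompletion v ℓ hv).IsDeRhamFramed (ρ.toLocal v)) → ∃ π : Literature.NumberTheory.Automorphic.CuspidalAutomorphicRepData n K hcpt, π.1.IsLAlgebraic ∧ ∀ᶠ v : IsDedekindDomain.HeightOneSpectrum (NumberField.RingOfIntegers K) in cofinite, SatakeFrobCompatibleAt ι π.1 ρ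 v) →
    (∀ (K : Type) [Field K] [NumberField K], ∃ Rec : ReciprocityData K, ∀ (n : ℕ) (hcpt : Literature.NumberTheory.Automorphic.isCompact_glFiniteIntegralLevel n K), 0 < n → ∀ (π : Literature.NumberTheory.Automorphic.CuspidalAutomorphicRepData n K hcpt), π.1.IsLAlgebraic → ∀ (ℓ : ℕ) [Fact ℓ.Prime] (ι : PadicAlgCl ℓ ≃+* ℂ) (ρ : Literature.NumberTheory.GaloisRepresentations.FramedGaloisRep K (PadicAlgCl ℓ) n), ρ.toGaloisRep.IsIrreducible → (∀ᶠ v : IsDedekindDomain.HeightOneSpectrum (NumberField.RingOfIntegers K) in cofinite, SatakeFrobCompatibleAt ι π.1 ρ v) → ∀ v : IsDedekindDomain.HeightOneSpectrum (NumberField.RingOfIntegers K), (∀ hv : ((ℓ : ℕ) : NumberField.RingOfIntegers K) ∈ v.asIdeal, (Rec.pst ℓ v hv).IsDeRhamFramed (ρ.toLocal v)) → LocalGlobalCompatibleAt Rec ι π.1 ρ v) →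
    Summit.Langlands.Langlands.Theses.HeckeFieldDeRham.ReciprocityModuloDeRham := by
  intro hW hB hL F _ _
  obtain ⟨Rec, hRec⟩ := hL F
  refine ⟨Rec, fun n hn hcpt => ⟨?_, ?_⟩⟩
  · intro π hπ ℓ _ ι
    obtain ⟨ρ, hirr, hsat⟩ := hW F n hcpt hn π hπ ℓ ι
    refine ⟨ρ, hirr, hsat, ?_, ?_, ?_⟩
    · intro v hv
      exact hRec n hcpt hn π hπ ℓ ι ρ hirr hsat v (fun hv' => absurd hv' hv)
    · intro v hv hdR
      exact hRec n hcpt hn π hπ ℓ ι ρ hirr hsat v (fun _ => hdR)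
    · intro ρ' hρ'
      exact Theorems.ReciprocityUpToIrreducibility.isConjugate_of_satakeFrobCompatibleAt π.1 ι hirr hsat hρ'.1
  · intro ℓ _ ι ρ hirr hgeo
    obtain ⟨π, hπ, hsat⟩ := hB F n hcpt hn ℓ ι ρ hirr ⟨hgeo.1, fun v hv => hgeo.2 v hv⟩
    exact ⟨π, hπ, hsat, fun v => hRec n hcpt hn π hπ ℓ ι ρ hirr hsat v (fun hv => hgeo.2 v hv)⟩

/-- The crux modulo exactly the three registered stubs. -/
theorem ReciprocityModuloDeRham_of_stubs :
    Summit.Langlands.Langlands.Theses.HeckeFieldDeRham.ReciprocityModuloDeRham :=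
  ReciprocityModuloDeRham_of stub_satakeAvatarExistence stub_weakGeometricAutomorphy stub_pairCompatibilityModuloDeRham

end Summit.Langlands.Langlands.Cruxes.ReciprocityModuloDeRham.Leaves
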